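import Summits.Parity.GeneralizedHardyLittlewood.Theorems.PrimeLevelFamEdgeMomentsBeyondDiagonalTwoOrderDictionary
import Summits.Parity.GeneralizedHardyLittlewood.Theorems.PrimeLevelFamEdgeMomentsBeyondDiagonalDictionaryAtOneBounds
import HarnessLib

/-!
# Route `PrimeLevelFamEdge`, crux K_A `MomentsBeyondDiagonal` (stmt-Parity-20007), line «petersson_layers» v4:
# THE IDENTIFICATION GAP AT EVERY `Q`, REDUCED TO PER-ORDER BOX / OFF-BOX TERMS (exact identities; no estimate)

`stub_identP : TailNearFar rhoP` says `tail + far = Q^h(P,Q)(q̂^{Δ'}) − (diagPart − Σ_{r ≤ q⁸} layer r) = O(q̂ log⁻³ q̂)` for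
every admissible `P` and every even-or-odd `Q` (`tail_add_farLayers`); at `Q = 1` it is the tree's `tailNearFar_atOne` (p634139),
whose proof is: exact dictionary ⇒ gap = BOX ERROR (Petersson layer tail `r > q⁸` inside the AFE box) + OFF-BOX series, then two
norm bounds. With the two-order dictionary (`…TwoOrderDictionary`, p794097) the SAME reduction holds at every `Q`:
* §1 `diagPart_sub_sum_layer`: `diagPart − Σ_{r≤R} layer r = spectralSum(δ − Σ_{r≤R} layerKernel r)` (every `Q`; kernel linearity);
* §2 `QhPQ_sub_explicit_eq_sum_orders`: `Q^h(P,Q)(q̂^{Δ'}) − (diagPart − Σ_{r≤R} layer r) = Σ_{i,j ≤ deg Q} QᵢQⱼ ℓ^{−(i+j)} · GAP_{ij}`,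
  `GAP_{ij} = Σʰ Λ^{(i)}Λ^{(j)} M_P² − (1+(−1)^{i+j}) q̂ Σ_{n ∈ box²} (n₁n₂)^{−1/2} W_{ij} Σ_{m} x x Σ_{d} [δ − Σ_{r≤R} layerKernel r](a,b)`;
* §3 `harmonicSum_derivLambda_mul_sq_sub_box_eq`: for `⌊M⌋ < q` and ANY box kernel `κ`,
  `Σʰ Λ^{(i)}Λ^{(j)} M_P² − (1+(−1)^{i+j}) q̂ Σ_{box²} (…) κ = (1+(−1)^{i+j}) q̂ Σ_{box²} (n₁n₂)^{−1/2} W_{ij} Σ_m x x Σ_d [pet − κ](a,b)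
   + Σ'_{n ∉ box²} (1+(−1)^{i+j}) q̂ ((n₁n₂)^{−1/2} W_{ij} Σ_m x x Σ_d pet(a,b))` (box part + off-box series).
So `stub_identP` at every `Q` ⇐ per-`(i,j)` norm bounds for the box error (with `pet − δ + Σ_{r≤q⁸} layerKernel = −Σ_{r>q⁸} layerKernel`,
`pet_sub_kernel_eq_neg_tsum`) and the off-box series, with the weight `W_{ij}` (`KMV2000.norm_afeW_le`) in place of `W = W₀₀`
(`…DictionaryAtOneBoxError`, `…IdentificationAtOne` §1–§2 are the `i = j = 0` instances). Those two estimates are NOT done here.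
Proof only; nothing about Landau–Siegel zeros; K_A NOT proved.
-/

noncomputable section

open scoped Real
open Complex Finset Polynomial CongruenceSubgroup
open Literature.NumberTheory.EllipticCurves.ModularForms
open Literature.NumberTheory.LFunctions

namespace Summit.Parity.GeneralizedHardyLittlewood.Theorems.MomentsBeyondDiagonal.TwoOrderAFE

open Summit.Parity.GeneralizedHardyLittlewood.Theorems.PrimeLevelFamEdgeIdeaDeltas.PeterssonLayers
  (spectralSum afeBox diagKernel layerKernel diagPart layer spectralSum_kernel_sub spectralSum_kernel_finset_sum afeW_eq_kmv)

/-! ## §1. The explicit piece as ONE spectral sum (every `Q`) -/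

/-- **§1.** `diagPart q P Q Δ' − Σ_{r ∈ [1,R]} layer q P Q Δ' r = spectralSum q P Q Δ' (δ − Σ_{r ≤ R} layerKernel q r)` for every `Q`
(kernel-linearity of `spectralSum`; the tree's `diagPart_sub_sum_layer_one` is `Q = 1`). -/
theorem diagPart_sub_sum_layer (q : ℕ) [NeZero q] (P Q : ℝ[X]) (Δ' : ℝ) (R : ℕ) :
    diagPart q P Q Δ' - ∑ r ∈ Icc 1 R, layer q P Q Δ' r =
      spectralSum q P Q Δ' (fun a b ↦ diagKernel a b - ∑ r ∈ Icc 1 R, layerKernel q r a b) := by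
  unfold diagPart layer
  rw [← spectralSum_kernel_finset_sum, ← spectralSum_kernel_sub]

/-! ## §2. The gap in orders -/

/-- **§2. THE GAP IN ORDERS (every `Q`, `q` prime).** `Q^h(P,Q)(q̂^{Δ'}) − (diagPart − Σ_{r≤R} layer r)
= Σ_{i,j ≤ deg Q} QᵢQⱼ ℓ^{−(i+j)} · (Σʰ Λ^{(i)}Λ^{(j)} M_P² − (1+(−1)^{i+j}) q̂ Σ_{n₁,n₂ ≤ q²} (n₁n₂)^{−1/2} W_{ij}(q̂;n₁,n₂)
Σ_{m₁,m₂ ≤ M} x x Σ_{d₁,d₂} [δ − Σ_{r≤R} layerKernel r](a,b))`, `M = q̂^{Δ'}` (`QhPQ_eq_sum_orders` + §1 + the definition of `spectralSum`).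
[cite: KowalskiMichelVanderKam2000, §6 p. 19 (Q̃, Q^h(P,Q)) and (21)–(22) p. 12] -/
theorem QhPQ_sub_explicit_eq_sum_orders {q : ℕ} [NeZero q] (hq : q.Prime) (P Q : ℝ[X]) (Δ' : ℝ) (R : ℕ) :
    KMV2000.QhPQ q P Q (KMV2000.qhat q ^ Δ') - (diagPart q P Q Δ' - ∑ r ∈ Icc 1 R, layer q P Q Δ' r) =
      ∑ i ∈ range (Q.natDegree + 1), ∑ j ∈ range (Q.natDegree + 1),
        (Q.coeff i : ℂ) * (Q.coeff j : ℂ) * (((Real.log (KMV2000.qhat q))⁻¹ : ℝ) : ℂ) ^ (i + j) *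
          (GL2Family.harmonicSum q 2 (fun f ↦ KMV2000.derivLambda q i f * KMV2000.derivLambda q j f *
              KMV2000.mollifierP q P (KMV2000.qhat q ^ Δ') f ^ 2) -
            (1 + (-1 : ℂ) ^ (i + j)) * (KMV2000.qhat q : ℂ) *
              ∑ n₁ ∈ afeBox q, ∑ n₂ ∈ afeBox q,
                ((((n₁ : ℝ) * n₂) ^ (-(1 / 2 : ℝ)) : ℝ) : ℂ) * KMV2000.afeW (KMV2000.qhat q) i j n₁ n₂ *
                ∑ m₁ ∈ Icc 1 ⌊KMV2000.qhat q ^ Δ'⌋₊, ∑ m₂ ∈ Icc 1 ⌊KMV2000.qhat q ^ Δ'⌋₊,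
                  (KMV2000.mollifierCoeff P (KMV2000.qhat q ^ Δ') m₁ : ℂ) *
                    (KMV2000.mollifierCoeff P (KMV2000.qhat q ^ Δ') m₂ : ℂ) *
                  ∑ d₁ ∈ (Nat.gcd m₁ n₁).divisors, ∑ d₂ ∈ (Nat.gcd m₂ n₂).divisors,
                    (diagKernel (m₁ * n₁ / d₁ ^ 2) (m₂ * n₂ / d₂ ^ 2) -
                      ∑ r ∈ Icc 1 R, layerKernel q r (m₁ * n₁ / d₁ ^ 2) (m₂ * n₂ / d₂ ^ 2))) := by
  rw [QhPQ_eq_sum_orders hq, diagPart_sub_sum_layer, spectralSum, ← Finset.sum_sub_distrib]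
  refine Finset.sum_congr rfl fun i _ ↦ ?_
  rw [← Finset.sum_sub_distrib]
  refine Finset.sum_congr rfl fun j _ ↦ ?_
  simp only [afeW_eq_kmv]
  ring

/-! ## §3. Per order: box part + off-box series -/

/-- Linearity of the two-order box sum in its pair kernel. -/
theorem boxSum₂_kernel_sub (q : ℕ) [NeZero q] (P : ℝ[X]) (M : ℝ) (i j : ℕ) (κ₁ κ₂ : ℕ → ℕ → ℂ) :
    ∑ n₁ ∈ afeBox q, ∑ n₂ ∈ afeBox q,
        ((((n₁ : ℝ) * n₂) ^ (-(1 / 2 : ℝ)) : ℝ) : ℂ) * KMV2000.afeW (KMV2000.qhat q) i j n₁ n₂ *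
        ∑ m₁ ∈ Icc 1 ⌊M⌋₊, ∑ m₂ ∈ Icc 1 ⌊M⌋₊,
          (KMV2000.mollifierCoeff P M m₁ : ℂ) * (KMV2000.mollifierCoeff P M m₂ : ℂ) *
          ∑ d₁ ∈ (Nat.gcd m₁ n₁).divisors, ∑ d₂ ∈ (Nat.gcd m₂ n₂).divisors,
            (κ₁ (m₁ * n₁ / d₁ ^ 2) (m₂ * n₂ / d₂ ^ 2) - κ₂ (m₁ * n₁ / d₁ ^ 2) (m₂ * n₂ / d₂ ^ 2)) =
      (∑ n₁ ∈ afeBox q, ∑ n₂ ∈ afeBox q,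
        ((((n₁ : ℝ) * n₂) ^ (-(1 / 2 : ℝ)) : ℝ) : ℂ) * KMV2000.afeW (KMV2000.qhat q) i j n₁ n₂ *
        ∑ m₁ ∈ Icc 1 ⌊M⌋₊, ∑ m₂ ∈ Icc 1 ⌊M⌋₊,
          (KMV2000.mollifierCoeff P M m₁ : ℂ) * (KMV2000.mollifierCoeff P M m₂ : ℂ) *
          ∑ d₁ ∈ (Nat.gcd m₁ n₁).divisors, ∑ d₂ ∈ (Nat.gcd m₂ n₂).divisors,
            κ₁ (m₁ * n₁ / d₁ ^ 2) (m₂ * n₂ / d₂ ^ 2)) -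
      (∑ n₁ ∈ afeBox q, ∑ n₂ ∈ afeBox q,
        ((((n₁ : ℝ) * n₂) ^ (-(1 / 2 : ℝ)) : ℝ) : ℂ) * KMV2000.afeW (KMV2000.qhat q) i j n₁ n₂ *
        ∑ m₁ ∈ Icc 1 ⌊M⌋₊, ∑ m₂ ∈ Icc 1 ⌊M⌋₊,
          (KMV2000.mollifierCoeff P M m₁ : ℂ) * (KMV2000.mollifierCoeff P M m₂ : ℂ) *
          ∑ d₁ ∈ (Nat.gcd m₁ n₁).divisors, ∑ d₂ ∈ (Nat.gcd m₂ n₂).divisors,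
            κ₂ (m₁ * n₁ / d₁ ^ 2) (m₂ * n₂ / d₂ ^ 2)) := by
  simp only [Finset.sum_sub_distrib, mul_sub]

/-- **§3. BOX PART + OFF-BOX SERIES, per order `(i,j)`** (`q` prime, `⌊M⌋ < q`, any box kernel `κ`):
`Σʰ Λ^{(i)}Λ^{(j)} M_P² − (1+(−1)^{i+j}) q̂ Σ_{box²} (n₁n₂)^{−1/2} W_{ij} Σ_m x x Σ_d κ(a,b)
 = (1+(−1)^{i+j}) q̂ Σ_{box²} (n₁n₂)^{−1/2} W_{ij} Σ_m x x Σ_d [pet q a b − κ a b] + Σ'_{n ∉ box²} (1+(−1)^{i+j}) q̂ ((n₁n₂)^{−1/2} W_{ij} Σ_m x x Σ_d pet q a b)`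
— the two-order dictionary split along the AFE box. With `κ = δ − Σ_{r≤q⁸} layerKernel q r` the box kernel `pet − κ` is the
Petersson layer tail `−Σ_{r>q⁸} layerKernel q r` (`pet_sub_kernel_eq_neg_tsum`). [cite: KowalskiMichelVanderKam2000, (21)–(22) p. 12 with Lemma 3.1 (10)] -/
theorem harmonicSum_derivLambda_mul_sq_sub_box_eq {q : ℕ} [NeZero q] (hq : q.Prime) (P : ℝ[X]) {M : ℝ}
    (hM : ⌊M⌋₊ < q) (i j : ℕ) (κ : ℕ → ℕ → ℂ) :
    GL2Family.harmonicSum q 2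
        (fun f ↦ KMV2000.derivLambda q i f * KMV2000.derivLambda q j f * KMV2000.mollifierP q P M f ^ 2) -
      (1 + (-1 : ℂ) ^ (i + j)) * (KMV2000.qhat q : ℂ) *
        ∑ n₁ ∈ afeBox q, ∑ n₂ ∈ afeBox q,
          ((((n₁ : ℝ) * n₂) ^ (-(1 / 2 : ℝ)) : ℝ) : ℂ) * KMV2000.afeW (KMV2000.qhat q) i j n₁ n₂ *
          ∑ m₁ ∈ Icc 1 ⌊M⌋₊, ∑ m₂ ∈ Icc 1 ⌊M⌋₊,
            (KMV2000.mollifierCoeff P M m₁ : ℂ) * (KMV2000.mollifierCoeff P M m₂ : ℂ) *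
            ∑ d₁ ∈ (Nat.gcd m₁ n₁).divisors, ∑ d₂ ∈ (Nat.gcd m₂ n₂).divisors,
              κ (m₁ * n₁ / d₁ ^ 2) (m₂ * n₂ / d₂ ^ 2) =
      (1 + (-1 : ℂ) ^ (i + j)) * (KMV2000.qhat q : ℂ) *
        ∑ n₁ ∈ afeBox q, ∑ n₂ ∈ afeBox q,
          ((((n₁ : ℝ) * n₂) ^ (-(1 / 2 : ℝ)) : ℝ) : ℂ) * KMV2000.afeW (KMV2000.qhat q) i j n₁ n₂ *
          ∑ m₁ ∈ Icc 1 ⌊M⌋₊, ∑ m₂ ∈ Icc 1 ⌊M⌋₊,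
            (KMV2000.mollifierCoeff P M m₁ : ℂ) * (KMV2000.mollifierCoeff P M m₂ : ℂ) *
            ∑ d₁ ∈ (Nat.gcd m₁ n₁).divisors, ∑ d₂ ∈ (Nat.gcd m₂ n₂).divisors,
              (KowalskiMichel2000.pet q (m₁ * n₁ / d₁ ^ 2) (m₂ * n₂ / d₂ ^ 2) - κ (m₁ * n₁ / d₁ ^ 2) (m₂ * n₂ / d₂ ^ 2)) +
      ∑' x : {n : ℕ × ℕ // n ∉ afeBox q ×ˢ afeBox q},
        (1 + (-1 : ℂ) ^ (i + j)) * (KMV2000.qhat q : ℂ) *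
          (((((x.1.1 : ℝ) * x.1.2) ^ (-(1 / 2 : ℝ)) : ℝ) : ℂ) * KMV2000.afeW (KMV2000.qhat q) i j x.1.1 x.1.2 *
          ∑ m₁ ∈ Icc 1 ⌊M⌋₊, ∑ m₂ ∈ Icc 1 ⌊M⌋₊,
            (KMV2000.mollifierCoeff P M m₁ : ℂ) * (KMV2000.mollifierCoeff P M m₂ : ℂ) *
            ∑ d₁ ∈ (Nat.gcd m₁ x.1.1).divisors, ∑ d₂ ∈ (Nat.gcd m₂ x.1.2).divisors,
              KowalskiMichel2000.pet q (m₁ * x.1.1 / d₁ ^ 2) (m₂ * x.1.2 / d₂ ^ 2)) := by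
  have hsplit :
      (∑ n₁ ∈ afeBox q, ∑ n₂ ∈ afeBox q, (1 + (-1 : ℂ) ^ (i + j)) * (KMV2000.qhat q : ℂ) *
        (((((n₁ : ℝ) * n₂) ^ (-(1 / 2 : ℝ)) : ℝ) : ℂ) * KMV2000.afeW (KMV2000.qhat q) i j n₁ n₂ *
        ∑ m₁ ∈ Icc 1 ⌊M⌋₊, ∑ m₂ ∈ Icc 1 ⌊M⌋₊,
          (KMV2000.mollifierCoeff P M m₁ : ℂ) * (KMV2000.mollifierCoeff P M m₂ : ℂ) *
          ∑ d₁ ∈ (Nat.gcd m₁ n₁).divisors, ∑ d₂ ∈ (Nat.gcd m₂ n₂).divisors,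
            KowalskiMichel2000.pet q (m₁ * n₁ / d₁ ^ 2) (m₂ * n₂ / d₂ ^ 2))) +
      (∑' x : {n : ℕ × ℕ // n ∉ afeBox q ×ˢ afeBox q},
        (1 + (-1 : ℂ) ^ (i + j)) * (KMV2000.qhat q : ℂ) *
          (((((x.1.1 : ℝ) * x.1.2) ^ (-(1 / 2 : ℝ)) : ℝ) : ℂ) * KMV2000.afeW (KMV2000.qhat q) i j x.1.1 x.1.2 *
          ∑ m₁ ∈ Icc 1 ⌊M⌋₊, ∑ m₂ ∈ Icc 1 ⌊M⌋₊,
            (KMV2000.mollifierCoeff P M m₁ : ℂ) * (KMV2000.mollifierCoeff P M m₂ : ℂ) *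
            ∑ d₁ ∈ (Nat.gcd m₁ x.1.1).divisors, ∑ d₂ ∈ (Nat.gcd m₂ x.1.2).divisors,
              KowalskiMichel2000.pet q (m₁ * x.1.1 / d₁ ^ 2) (m₂ * x.1.2 / d₂ ^ 2))) =
      ∑' n : ℕ × ℕ, (1 + (-1 : ℂ) ^ (i + j)) * (KMV2000.qhat q : ℂ) *
        (((((n.1 : ℝ) * n.2) ^ (-(1 / 2 : ℝ)) : ℝ) : ℂ) * KMV2000.afeW (KMV2000.qhat q) i j n.1 n.2 *
        ∑ m₁ ∈ Icc 1 ⌊M⌋₊, ∑ m₂ ∈ Icc 1 ⌊M⌋₊,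
          (KMV2000.mollifierCoeff P M m₁ : ℂ) * (KMV2000.mollifierCoeff P M m₂ : ℂ) *
          ∑ d₁ ∈ (Nat.gcd m₁ n.1).divisors, ∑ d₂ ∈ (Nat.gcd m₂ n.2).divisors,
            KowalskiMichel2000.pet q (m₁ * n.1 / d₁ ^ 2) (m₂ * n.2 / d₂ ^ 2)) := by
    have h0 := (summable_dictionaryTerm₂ hq P hM i j).sum_add_tsum_compl (s := afeBox q ×ˢ afeBox q)
    rw [Finset.sum_product] at h0
    exact h0
  rw [harmonicSum_derivLambda_mul_sq_eq_tsum_pet hq P hM i j, ← hsplit]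
  have hfac : (∑ n₁ ∈ afeBox q, ∑ n₂ ∈ afeBox q, (1 + (-1 : ℂ) ^ (i + j)) * (KMV2000.qhat q : ℂ) *
        (((((n₁ : ℝ) * n₂) ^ (-(1 / 2 : ℝ)) : ℝ) : ℂ) * KMV2000.afeW (KMV2000.qhat q) i j n₁ n₂ *
        ∑ m₁ ∈ Icc 1 ⌊M⌋₊, ∑ m₂ ∈ Icc 1 ⌊M⌋₊,
          (KMV2000.mollifierCoeff P M m₁ : ℂ) * (KMV2000.mollifierCoeff P M m₂ : ℂ) *
          ∑ d₁ ∈ (Nat.gcd m₁ n₁).divisors, ∑ d₂ ∈ (Nat.gcd m₂ n₂).divisors,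
            KowalskiMichel2000.pet q (m₁ * n₁ / d₁ ^ 2) (m₂ * n₂ / d₂ ^ 2))) =
      (1 + (-1 : ℂ) ^ (i + j)) * (KMV2000.qhat q : ℂ) * ∑ n₁ ∈ afeBox q, ∑ n₂ ∈ afeBox q,
        ((((n₁ : ℝ) * n₂) ^ (-(1 / 2 : ℝ)) : ℝ) : ℂ) * KMV2000.afeW (KMV2000.qhat q) i j n₁ n₂ *
        ∑ m₁ ∈ Icc 1 ⌊M⌋₊, ∑ m₂ ∈ Icc 1 ⌊M⌋₊,
          (KMV2000.mollifierCoeff P M m₁ : ℂ) * (KMV2000.mollifierCoeff P M m₂ : ℂ) *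
          ∑ d₁ ∈ (Nat.gcd m₁ n₁).divisors, ∑ d₂ ∈ (Nat.gcd m₂ n₂).divisors,
            KowalskiMichel2000.pet q (m₁ * n₁ / d₁ ^ 2) (m₂ * n₂ / d₂ ^ 2) := by
    rw [Finset.mul_sum]
    refine Finset.sum_congr rfl fun n₁ _ ↦ ?_
    rw [Finset.mul_sum]
  rw [hfac, boxSum₂_kernel_sub]
  ring

end Summit.Parity.GeneralizedHardyLittlewood.Theorems.MomentsBeyondDiagonal.TwoOrderAFE

end
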